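import Summits.QuantumFields.YangMills.Theorems.ColdStartUniversalityLatticeLangevinGradientFormTorus
import Summits.QuantumFields.YangMills.Theorems.ColdStartUniversalityShenZhuZhuFunctionalInequalitiesSU2
import HarnessLib

/-!
# Route `ColdStartUniversality` (fixed-cut-off package): SHEN–ZHU–ZHU'S THEOREM 1.4 (1.9)–(1.10) FOR `SU(2)`, `d = 3` IN THE PRINTED GRADIENT FORM,
# for every infinite-volume limit point — `Ent_μ(F²) ≤ (2/K) Σ_e μ(|∇_e F|²)`, `Var_μ(F) ≤ (1/K) Σ_e μ(|∇_e F|²)`, `K = 1 − 24|β|`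

Helper file (seat `ym-line-csu-p1`, g38; `--supports stmt-QuantumFields-24809`).  Passage to infinite-volume limit points of the torus gradient-form
inequalities of `…LatticeLangevinGradientFormTorus` (`torus_variance/entropy_le_sum_linkGradSq_of_hessBound`): along the subsequence of tori
defining a limit point `μ`, BOTH sides converge — `F`, `F²`, `F² log F²` and each squared link gradient `U ↦ |∇_e F|²(U)` (`linkGradSq Λ f e`,
continuous by `continuous_linkGradSq`) are bounded continuous cylinder functions.  Results, at tree coupling `β' = 2β`:
* ★★★ `szzGradientForm_su2_of_hessBound` — a frame-Hessian bound `K₀ < 2` on every torus gives, for every limit point `μ`, every finite `Λ ⊆ E⁺(ℤ³)`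
  and every smooth `f` of the link matrices over `Λ` (`F = f((U_e)_(e∈Λ))`):
  `Ent_μ(F²) ≤ (2/(1 − K₀/2)) Σ_(e∈Λ) ∫ linkGradSq Λ f e dμ` and `Var_μ(F) ≤ (1/(1 − K₀/2)) Σ_(e∈Λ) ∫ linkGradSq Λ f e dμ`;
* ★★★ `szzGradientForm_su2_sharp` — `|β| < 1/24`: the same with `K = 1 − 24|β|` (the venture `YMGap`'s sharp constant `N/2 − 4dN|β|`);
* ★★★ `szzGradientForm_su2_printed` — `|β| < 1/32`: the same with Shen–Zhu–Zhu's printed `K_S = N/2 − 8(d−1)N|β| = 1 − 32|β|` — Theorem 1.4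
  (1.9)–(1.10) / Corollary 4.5 (4.12)–(4.13) AS PRINTED (`μ(F² log F²) ≤ (2/K_S) Σ_e μ(|∇_eF|²)` for `μ(F²) = 1`, homogeneous form, and
  `μ(F²) ≤ (1/K_S) Σ_e μ(|∇_eF|²) + μ(F)²`) for `SU(2)` lattice Yang–Mills in three dimensions; the tree's named fact
  `shenZhuZhu_functionalInequalities 3 2` is its Lipschitz weakening (`|∇_e F|² ≤ L_e²`).
THEOREMS ONLY, no definition, no sorry.  HONEST FRAMING: STRONG-coupling, fixed-lattice statements; nothing at weak coupling / in the continuum,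
nothing `K`-uniform along the route's scaling (`UniformColdStartMixing`, 24809, ASIDE, not restated); no crux, rung or summit statement is proved;
the Yang–Mills mass gap is NOT proved.
-/

set_option autoImplicit false

noncomputable section

namespace Summit.QuantumFields.YangMills.Theorems.ColdStartUniversality

open MeasureTheory ProbabilityTheory Finset Filter Set Metric
open scoped BigOperators NNReal ENNReal Topology Matrix.Norms.Frobenius ContDiff
open Literature.Probability.Process Literature.MathematicalPhysics.QuantumFieldTheory
open Literature.MathematicalPhysics.QuantumLattice (fundamentalRep fundamentalLatticeRep continuous_fundamentalRep fundamentalRep_apply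
  torusEdge torusLift toTorusObservable toTorusObservable_apply infiniteVolumeLimitPoints IsInfiniteVolumeLimitAlong IsCylinder LGConfig)

/-- ★★★ **Shen–Zhu–Zhu's Corollary 4.5 in GRADIENT form for `SU(2)`, `d = 3`, from a frame-Hessian bound on every torus.**  If on every torus
`(ℤ/L)³` the frame Hessian of the plaquette function at tree coupling `2β` is bounded by `K₀ < 2` times the carré du champ, then for every
infinite-volume limit point `μ` at tree coupling `2β`, every finite `Λ ⊆ E⁺(ℤ³)` and every smooth `f` of the link matrices over `Λ`:
`∫F²log F² dμ − (∫F²dμ) log ∫F²dμ ≤ (2/(1 − K₀/2)) Σ_(e∈Λ) ∫ |∇_e F|² dμ` and `Var_μ(F) ≤ (1/(1 − K₀/2)) Σ_(e∈Λ) ∫ |∇_e F|² dμ`,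
`F = f((U_e)_(e∈Λ))`, `|∇_e F|² = linkGradSq Λ f e`. [cite: ShenZhuZhu2022, Theorem 1.4 (1.9)–(1.10) and §4 Corollary 4.5 (4.12)–(4.13)] -/
theorem szzGradientForm_su2_of_hessBound (β K₀ : ℝ) (hK : K₀ < 2)
    (hHess : ∀ (L : ℕ) [NeZero L], (∀ (V : (GaugeConfig 3 L (Matrix.specialUnitaryGroup (Fin 2) ℂ))) (Λ : (Edge 3 L × Fin (fundamentalLatticeRep 2).N × Fin (fundamentalLatticeRep 2).N × Bool → ℝ) →L[ℝ] ℝ),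
      ∑ n : Edge 3 L × NoiseIdx (fundamentalLatticeRep 2).N, ∑ m : Edge 3 L × NoiseIdx (fundamentalLatticeRep 2).N,
        Λ ((fun q : Edge 3 L × Fin (fundamentalLatticeRep 2).N × Fin (fundamentalLatticeRep 2).N × Bool => if n.1 = q.1 then (fun z : ℂ => if q.2.2.2 then z.im else z.re) (((Real.sqrt 2 : ℂ) • ((fundamentalLatticeRep 2).lieProj (noiseDir n.2) * (fun (ee : Edge 3 L) => Matrix.of fun (i j : Fin (fundamentalLatticeRep 2).N) => (((fun (V : GaugeConfig 3 L (Matrix.specialUnitaryGroup (Fin 2) ℂ)) (q : Edge 3 L × Fin (fundamentalLatticeRep 2).N × Fin (fundamentalLatticeRep 2).N × Bool) => (fun z : ℂ => if q.2.2.2 then z.im else z.re) ((fundamentalRep (Fin 2) (V q.1) : Matrix (Fin 2) (Fin 2) ℂ) q.2.1 q.2.2.1)) V (ee, i, j, false) : ℝ) : ℂ) + (((fun (V : GaugeConfig 3 L (Matrix.specialUnitaryGroup (Fin 2) ℂ)) (q : Edge 3 L × Fin (fundamentalLatticeRep 2).N × Fin (fundamentalLatticeRep 2).N × Bool) => (fun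 z : ℂ => if q.2.2.2 then z.im else z.re) ((fundamentalRep (Fin 2) (V q.1) : Matrix (Fin 2) (Fin 2) ℂ) q.2.1 q.2.2.1)) V (ee, i, j, true) : ℝ) : ℂ) * Complex.I) q.1)) q.2.1 q.2.2.1) else 0)) * Λ ((fun q : Edge 3 L × Fin (fundamentalLatticeRep 2).N × Fin (fundamentalLatticeRep 2).N × Bool => if m.1 = q.1 then (fun z : ℂ => if q.2.2.2 then z.im else z.re) (((Real.sqrt 2 : ℂ) • ((fundamentalLatticeRep 2).lieProj (noiseDir m.2) * (fun (ee : Edge 3 L) => Matrix.of fun (i j : Fin (fundamentalLatticeRep 2).N) => (((fun (V : GaugeConfig 3 L (Matrix.specialUnitaryGroup (Fin 2) ℂ)) (q : Edge 3 L × Fin (fundamentalLatticeRep 2).N × Fin (fundamentalLatticeRep 2).N × Bool) => (fun z : ℂ => if q.2.2.2 then z.im else z.re) ((fundamentalRep (Fin 2) (V q.1) : Matrix (Fin 2) (Fin 2) ℂ) q.2.1 q.2.2.1)) V (ee, i, j, false) : ℝ) : ℂ) + (((fun (V : GaugeConfig 3 L (Matrix.specialUnitaryGroup (Fin 2) ℂ))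 (q : Edge 3 L × Fin (fundamentalLatticeRep 2).N × Fin (fundamentalLatticeRep 2).N × Bool) => (fun z : ℂ => if q.2.2.2 then z.im else z.re) ((fundamentalRep (Fin 2) (V q.1) : Matrix (Fin 2) (Fin 2) ℂ) q.2.1 q.2.2.1)) V (ee, i, j, true) : ℝ) : ℂ) * Complex.I) q.1)) q.2.1 q.2.2.1) else 0)) *
          fderiv ℝ (fun z : (Edge 3 L × Fin (fundamentalLatticeRep 2).N × Fin (fundamentalLatticeRep 2).N × Bool → ℝ) => fderiv ℝ (fun y : (Edge 3 L × Fin (fundamentalLatticeRep 2).N × Fin (fundamentalLatticeRep 2).N × Bool → ℝ) => (((2 : ℕ) : ℝ) * β) * ∑ p : Plaquette 3 L, (rootedLoop (fun (ee : Edge 3 L) (i j : Fin (fundamentalLatticeRep 2).N) => ((y (ee, i, j, false) : ℝ) : ℂ) + ((y (ee, i, j, true) : ℝ) : ℂ) * Complex.I) (p.1, p.2.1.1) p.2.1.2 false).trace.re) z (fun q : Edge 3 L × Fin (fundamentalLatticeRep 2).N × Fin (fundamentalLatticeRep 2).N × Bool => if m.1 = q.1 then (fun z : ℂ => if q.2.2.2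 then z.im else z.re) (((Real.sqrt 2 : ℂ) • ((fundamentalLatticeRep 2).lieProj (noiseDir m.2) * (fun (ee : Edge 3 L) => Matrix.of fun (i j : Fin (fundamentalLatticeRep 2).N) => ((z (ee, i, j, false) : ℝ) : ℂ) + ((z (ee, i, j, true) : ℝ) : ℂ) * Complex.I) q.1)) q.2.1 q.2.2.1) else 0)) ((fun (V : GaugeConfig 3 L (Matrix.specialUnitaryGroup (Fin 2) ℂ)) (q : Edge 3 L × Fin (fundamentalLatticeRep 2).N × Fin (fundamentalLatticeRep 2).N × Bool) => (fun z : ℂ => if q.2.2.2 then z.im else z.re) ((fundamentalRep (Fin 2) (V q.1) : Matrix (Fin 2) (Fin 2) ℂ) q.2.1 q.2.2.1)) V) (fun q : Edge 3 L × Fin (fundamentalLatticeRep 2).N × Fin (fundamentalLatticeRep 2).N × Bool => if n.1 = q.1 then (fun z : ℂ => if q.2.2.2 then z.im else z.re) (((Real.sqrt 2 : ℂ) • ((fundamentalLatticeRep 2).lieProj (noiseDir n.2) * (fun (ee : Edge 3 L) => Matrix.of fun (i j : Fin (fundamentalLatticeRep 2).N) => (((fun (V : GaugeConfig 3 L (Matrix.specialUnitaryGroup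 (Fin 2) ℂ)) (q : Edge 3 L × Fin (fundamentalLatticeRep 2).N × Fin (fundamentalLatticeRep 2).N × Bool) => (fun z : ℂ => if q.2.2.2 then z.im else z.re) ((fundamentalRep (Fin 2) (V q.1) : Matrix (Fin 2) (Fin 2) ℂ) q.2.1 q.2.2.1)) V (ee, i, j, false) : ℝ) : ℂ) + (((fun (V : GaugeConfig 3 L (Matrix.specialUnitaryGroup (Fin 2) ℂ)) (q : Edge 3 L × Fin (fundamentalLatticeRep 2).N × Fin (fundamentalLatticeRep 2).N × Bool) => (fun z : ℂ => if q.2.2.2 then z.im else z.re) ((fundamentalRep (Fin 2) (V q.1) : Matrix (Fin 2) (Fin 2) ℂ) q.2.1 q.2.2.1)) V (ee, i, j, true) : ℝ) : ℂ) * Complex.I) q.1)) q.2.1 q.2.2.1) else 0)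
        ≤ K₀ * ∑ n : Edge 3 L × NoiseIdx (fundamentalLatticeRep 2).N, (Λ (fun q : Edge 3 L × Fin (fundamentalLatticeRep 2).N × Fin (fundamentalLatticeRep 2).N × Bool => if n.1 = q.1 then (fun z : ℂ => if q.2.2.2 then z.im else z.re) (((Real.sqrt 2 : ℂ) • ((fundamentalLatticeRep 2).lieProj (noiseDir n.2) * (fun (ee : Edge 3 L) => Matrix.of fun (i j : Fin (fundamentalLatticeRep 2).N) => (((fun (V : GaugeConfig 3 L (Matrix.specialUnitaryGroup (Fin 2) ℂ)) (q : Edge 3 L × Fin (fundamentalLatticeRep 2).N × Fin (fundamentalLatticeRep 2).N × Bool) => (fun z : ℂ => if q.2.2.2 then z.im else z.re) ((fundamentalRep (Fin 2) (V q.1) : Matrix (Fin 2) (Fin 2) ℂ) q.2.1 q.2.2.1)) V (ee, i, j, false) : ℝ) : ℂ) + (((fun (V : GaugeConfig 3 L (Matrix.specialUnitaryGroup (Fin 2) ℂ)) (q : Edge 3 L × Fin (fundamentalLatticeRep 2).N × Fin (fundamentalLatticeRep 2).N × Bool) => (fun z : ℂ => if q.2.2.2 then z.im else z.re) ((fundamentalRep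 (Fin 2) (V q.1) : Matrix (Fin 2) (Fin 2) ℂ) q.2.1 q.2.2.1)) V (ee, i, j, true) : ℝ) : ℂ) * Complex.I) q.1)) q.2.1 q.2.2.1) else 0)) ^ 2))
    {μ : Measure (LGConfig 3 (Matrix.specialUnitaryGroup (Fin 2) ℂ))}
    (hμ : μ ∈ infiniteVolumeLimitPoints (d := 3) (fundamentalRep (Fin 2)) (((2 : ℕ) : ℝ) * β))
    (Λ : Finset (Literature.MathematicalPhysics.QuantumLattice.ZdEdge 3)) (f : (↥Λ → Matrix (Fin 2) (Fin 2) ℂ) → ℝ) (hf : ContDiff ℝ ∞ f) :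
    ((∫ U, matrixCylinder Λ f U ^ 2 * Real.log (matrixCylinder Λ f U ^ 2) ∂μ) -
        (∫ U, matrixCylinder Λ f U ^ 2 ∂μ) * Real.log (∫ U, matrixCylinder Λ f U ^ 2 ∂μ) ≤
      2 / (1 - K₀ / 2) * ∑ e : ↥Λ, ∫ U, linkGradSq Λ f e (fun e' : ↥Λ => ((U e'.1 : Matrix.specialUnitaryGroup (Fin 2) ℂ) : Matrix (Fin 2) (Fin 2) ℂ)) ∂μ) ∧
    (Var[matrixCylinder Λ f; μ] ≤
      1 / (1 - K₀ / 2) * ∑ e : ↥Λ, ∫ U, linkGradSq Λ f e (fun e' : ↥Λ => ((U e'.1 : Matrix.specialUnitaryGroup (Fin 2) ℂ) : Matrix (Fin 2) (Fin 2) ℂ)) ∂μ) := by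
  classical
  obtain ⟨Ls, hLs, hprob, hlim⟩ := hμ
  haveI := hprob
  have hKpos : 0 < 1 - K₀ / 2 := by linarith
  set β' : ℝ := ((2 : ℕ) : ℝ) * β with hβ'
  set F : LGConfig 3 (Matrix.specialUnitaryGroup (Fin 2) ℂ) → ℝ := matrixCylinder Λ f with hF
  set Gr : ↥Λ → LGConfig 3 (Matrix.specialUnitaryGroup (Fin 2) ℂ) → ℝ :=
    fun e U => linkGradSq Λ f e (fun e' : ↥Λ => ((U e'.1 : Matrix.specialUnitaryGroup (Fin 2) ℂ) : Matrix (Fin 2) (Fin 2) ℂ)) with hGr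
  set S : ℝ := ∑ e : ↥Λ, ∫ U, Gr e U ∂μ with hSdef
  -- bounded continuous cylinder functions
  have hbdd : ∀ {G : LGConfig 3 (Matrix.specialUnitaryGroup (Fin 2) ℂ) → ℝ}, Continuous G → ∃ C, ∀ U, |G U| ≤ C := by
    intro G hG
    obtain ⟨C, hC⟩ := (isCompact_univ (X := LGConfig 3 (Matrix.specialUnitaryGroup (Fin 2) ℂ))).exists_bound_of_continuousOn hG.continuousOn
    exact ⟨C, fun U => by simpa [Real.norm_eq_abs] using hC U (Set.mem_univ _)⟩
  have hres : Continuous fun U : LGConfig 3 (Matrix.specialUnitaryGroup (Fin 2) ℂ) =>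
      (fun e' : ↥Λ => ((U e'.1 : Matrix.specialUnitaryGroup (Fin 2) ℂ) : Matrix (Fin 2) (Fin 2) ℂ)) :=
    continuous_pi fun e => continuous_subtype_val.comp (continuous_apply _)
  have hFcyl : IsCylinder F Λ := isCylinder_matrixCylinder Λ f
  have hFc : Continuous F := hf.continuous.comp hres
  obtain ⟨C, hC⟩ := hbdd hFc
  have hF2cyl : IsCylinder (fun U => F U ^ 2) Λ := fun U V hUV => by
    show F U ^ 2 = F V ^ 2
    rw [hFcyl hUV]
  have hF2c : Continuous fun U => F U ^ 2 := hFc.pow 2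
  have hF3cyl : IsCylinder (fun U => F U ^ 2 * Real.log (F U ^ 2)) Λ := fun U V hUV => by
    show F U ^ 2 * Real.log (F U ^ 2) = F V ^ 2 * Real.log (F V ^ 2)
    rw [hFcyl hUV]
  have hF3c : Continuous fun U => F U ^ 2 * Real.log (F U ^ 2) := Real.continuous_mul_log.comp hF2c
  have hGcyl : ∀ e : ↥Λ, IsCylinder (Gr e) Λ := fun e U V hUV => by
    show linkGradSq Λ f e _ = linkGradSq Λ f e _
    have h : (fun e' : ↥Λ => ((U e'.1 : Matrix.specialUnitaryGroup (Fin 2) ℂ) : Matrix (Fin 2) (Fin 2) ℂ)) =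
        fun e' : ↥Λ => ((V e'.1 : Matrix.specialUnitaryGroup (Fin 2) ℂ) : Matrix (Fin 2) (Fin 2) ℂ) := by
      funext e'; rw [hUV e'.1 e'.2]
    rw [h]
  have hGc : ∀ e : ↥Λ, Continuous (Gr e) := fun e => (continuous_linkGradSq Λ hf e).comp hres
  have ht1 := hlim F Λ hFcyl hFc ⟨C, hC⟩
  have ht2 := hlim (fun U => F U ^ 2) Λ hF2cyl hF2c (hbdd hF2c)
  have ht3 := hlim (fun U => F U ^ 2 * Real.log (F U ^ 2)) Λ hF3cyl hF3c (hbdd hF3c)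
  have htG : Tendsto (fun k => ∑ e : ↥Λ, wilsonExpectation (L := Ls k + 1) (fundamentalRep (Fin 2)) β' (toTorusObservable (Ls k + 1) (Gr e)))
      atTop (𝓝 S) :=
    tendsto_finsetSum _ fun e _ => hlim (Gr e) Λ (hGcyl e) (hGc e) (hbdd (hGc e))
  -- the variance and the entropy of `μ` as limits of the torus quantities
  have hFm : AEStronglyMeasurable F μ := hFc.aestronglyMeasurable
  have hmem : MemLp F 2 μ := MemLp.of_bound hFm C (ae_of_all _ fun U => by
    rw [Real.norm_eq_abs]; exact hC U)
  have hvarμ : Var[F; μ] = (∫ U, F U ^ 2 ∂μ) - (∫ U, F U ∂μ) ^ 2 := by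
    rw [variance_eq_sub hmem]
    rfl
  have htv : Tendsto (fun k => wilsonExpectation (L := Ls k + 1) (fundamentalRep (Fin 2)) β'
        (toTorusObservable (Ls k + 1) fun U => F U ^ 2) -
      wilsonExpectation (L := Ls k + 1) (fundamentalRep (Fin 2)) β' (toTorusObservable (Ls k + 1) F) ^ 2)
      atTop (𝓝 (Var[F; μ])) := by
    rw [hvarμ]
    exact ht2.sub (ht1.pow 2)
  have hte : Tendsto (fun k => wilsonExpectation (L := Ls k + 1) (fundamentalRep (Fin 2)) β'
        (toTorusObservable (Ls k + 1) fun U => F U ^ 2 * Real.log (F U ^ 2)) -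
      wilsonExpectation (L := Ls k + 1) (fundamentalRep (Fin 2)) β' (toTorusObservable (Ls k + 1) fun U => F U ^ 2) *
        Real.log (wilsonExpectation (L := Ls k + 1) (fundamentalRep (Fin 2)) β' (toTorusObservable (Ls k + 1) fun U => F U ^ 2)))
      atTop (𝓝 ((∫ U, F U ^ 2 * Real.log (F U ^ 2) ∂μ) - (∫ U, F U ^ 2 ∂μ) * Real.log (∫ U, F U ^ 2 ∂μ))) :=
    ht3.sub ((Real.continuous_mul_log.tendsto _).comp ht2)
  -- on every torus large enough, the torus gradient-form inequalities
  have hev : ∀ᶠ k : ℕ in atTop,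
      (wilsonExpectation (L := Ls k + 1) (fundamentalRep (Fin 2)) β'
          (toTorusObservable (Ls k + 1) fun U => F U ^ 2 * Real.log (F U ^ 2)) -
        wilsonExpectation (L := Ls k + 1) (fundamentalRep (Fin 2)) β' (toTorusObservable (Ls k + 1) fun U => F U ^ 2) *
          Real.log (wilsonExpectation (L := Ls k + 1) (fundamentalRep (Fin 2)) β' (toTorusObservable (Ls k + 1) fun U => F U ^ 2))
        ≤ 2 / (1 - K₀ / 2) * ∑ e : ↥Λ, wilsonExpectation (L := Ls k + 1) (fundamentalRep (Fin 2)) β' (toTorusObservable (Ls k + 1) (Gr e))) ∧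
      (wilsonExpectation (L := Ls k + 1) (fundamentalRep (Fin 2)) β'
          (toTorusObservable (Ls k + 1) fun U => F U ^ 2) -
        wilsonExpectation (L := Ls k + 1) (fundamentalRep (Fin 2)) β' (toTorusObservable (Ls k + 1) F) ^ 2
        ≤ 1 / (1 - K₀ / 2) * ∑ e : ↥Λ, wilsonExpectation (L := Ls k + 1) (fundamentalRep (Fin 2)) β' (toTorusObservable (Ls k + 1) (Gr e))) := by
    have hinj : ∀ᶠ k : ℕ in atTop, Set.InjOn (torusEdge (d := 3) (Ls k + 1)) ↑Λ := by
      have h1 := eventually_injOn_torusEdge' (d := 3) Λ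
      have h2 : Tendsto (fun k => Ls k + 1) atTop atTop :=
        tendsto_atTop_mono (fun k => Nat.le_succ (Ls k)) hLs.tendsto_atTop
      exact h2.eventually h1
    refine hinj.mono fun k hk => ?_
    set L : ℕ := Ls k + 1 with hL'
    set μ' : Measure (GaugeConfig 3 L (Matrix.specialUnitaryGroup (Fin 2) ℂ)) := (wilsonMeasure (d := 3) (L := L) (fundamentalRep (Fin 2)) β') with hμ'
    haveI : IsProbabilityMeasure μ' :=
      isProbabilityMeasure_wilsonMeasure (d := 3) (L := L) (fundamentalRep (Fin 2)) (continuous_fundamentalRep (Fin 2)) β'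
    have hTv := torus_variance_le_sum_linkGradSq_of_hessBound L β' K₀ hK (hHess L) Λ hk f hf
    have hTe := torus_entropy_le_sum_linkGradSq_of_hessBound L β' K₀ hK (hHess L) Λ hk f hf
    -- identify the torus quantities with Wilson expectations (definitional) and conclude
    have hFLc : Continuous fun V : (GaugeConfig 3 L (Matrix.specialUnitaryGroup (Fin 2) ℂ)) => F (torusLift L V) :=
      hFc.comp (continuous_pi fun e => continuous_apply (torusEdge L e))
    have hmemk : MemLp (fun V : (GaugeConfig 3 L (Matrix.specialUnitaryGroup (Fin 2) ℂ)) => F (torusLift L V)) 2 μ' :=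
      MemLp.of_bound hFLc.aestronglyMeasurable C (ae_of_all _ fun V => by
        rw [Real.norm_eq_abs]; exact hC (torusLift L V))
    have hv1 : Var[fun V : (GaugeConfig 3 L (Matrix.specialUnitaryGroup (Fin 2) ℂ)) => F (torusLift L V); μ'] =
        ∫ V, (F (torusLift L V) - ∫ V', F (torusLift L V') ∂μ') ^ 2 ∂μ' :=
      variance_eq_integral hFLc.measurable.aemeasurable
    have hv2 : Var[fun V : (GaugeConfig 3 L (Matrix.specialUnitaryGroup (Fin 2) ℂ)) => F (torusLift L V); μ'] =
        wilsonExpectation (L := L) (fundamentalRep (Fin 2)) β' (toTorusObservable L fun U => F U ^ 2) -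
          wilsonExpectation (L := L) (fundamentalRep (Fin 2)) β' (toTorusObservable L F) ^ 2 := by
      rw [variance_eq_sub hmemk]
      rfl
    refine ⟨?_, ?_⟩
    · rw [div_mul_eq_mul_div]
      exact hTe
    · rw [← hv2, hv1, one_div, inv_mul_eq_div]
      exact hTv
  -- pass to the limit
  have hE := le_of_tendsto_of_tendsto hte (htG.const_mul (2 / (1 - K₀ / 2))) (hev.mono fun k hk => hk.1)
  have hV := le_of_tendsto_of_tendsto htv (htG.const_mul (1 / (1 - K₀ / 2))) (hev.mono fun k hk => hk.2)
  exact ⟨hE, hV⟩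

/-- ★★★ **Shen–Zhu–Zhu's Theorem 1.4 (1.9)–(1.10) for `SU(2)`, `d = 3`, gradient form, SHARP window**: for every 't Hooft coupling `|β| < 1/24`,
every infinite-volume limit point `μ` of the torus `SU(2)` Wilson states at tree coupling `2β`, every finite `Λ ⊆ E⁺(ℤ³)` and every smooth `f`:
`Ent_μ(F²) ≤ (2/(1 − 24|β|)) Σ_(e∈Λ) ∫|∇_e F|² dμ` and `Var_μ(F) ≤ (1/(1 − 24|β|)) Σ_(e∈Λ) ∫|∇_e F|² dμ` (`|∇_e F|² = linkGradSq Λ f e`;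
`K = 1 − 24|β| = N/2 − 4dN|β|`, the venture `YMGap`'s kernel Hessian count, via `wilson_hessBound`).
[cite: ShenZhuZhu2022, Theorem 1.4 (1.9)–(1.10)] -/
theorem szzGradientForm_su2_sharp {β : ℝ} (hβ : |β| < 1 / 24)
    {μ : Measure (LGConfig 3 (Matrix.specialUnitaryGroup (Fin 2) ℂ))}
    (hμ : μ ∈ infiniteVolumeLimitPoints (d := 3) (fundamentalRep (Fin 2)) (((2 : ℕ) : ℝ) * β))
    (Λ : Finset (Literature.MathematicalPhysics.QuantumLattice.ZdEdge 3)) (f : (↥Λ → Matrix (Fin 2) (Fin 2) ℂ) → ℝ) (hf : ContDiff ℝ ∞ f) :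
    ((∫ U, matrixCylinder Λ f U ^ 2 * Real.log (matrixCylinder Λ f U ^ 2) ∂μ) -
        (∫ U, matrixCylinder Λ f U ^ 2 ∂μ) * Real.log (∫ U, matrixCylinder Λ f U ^ 2 ∂μ) ≤
      2 / (1 - 24 * |β|) * ∑ e : ↥Λ, ∫ U, linkGradSq Λ f e (fun e' : ↥Λ => ((U e'.1 : Matrix.specialUnitaryGroup (Fin 2) ℂ) : Matrix (Fin 2) (Fin 2) ℂ)) ∂μ) ∧
    (Var[matrixCylinder Λ f; μ] ≤
      1 / (1 - 24 * |β|) * ∑ e : ↥Λ, ∫ U, linkGradSq Λ f e (fun e' : ↥Λ => ((U e'.1 : Matrix.specialUnitaryGroup (Fin 2) ℂ) : Matrix (Fin 2) (Fin 2) ℂ)) ∂μ) := by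
  have h2 : |((2 : ℕ) : ℝ) * β| = 2 * |β| := by
    rw [abs_mul, Nat.cast_ofNat, abs_of_pos (by norm_num : (0 : ℝ) < 2)]
  have hK : 24 * |((2 : ℕ) : ℝ) * β| < 2 := by rw [h2]; linarith
  have h := szzGradientForm_su2_of_hessBound β (24 * |((2 : ℕ) : ℝ) * β|) hK
    (fun L _ => wilson_hessBound L (((2 : ℕ) : ℝ) * β)) hμ Λ f hf
  have e : 1 - 24 * |((2 : ℕ) : ℝ) * β| / 2 = 1 - 24 * |β| := by rw [h2]; ring
  rw [e] at h
  exact h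

/-- ★★★ **Shen–Zhu–Zhu's Theorem 1.4 (1.9)–(1.10) / Corollary 4.5 (4.12)–(4.13) AS PRINTED, for `SU(2)` lattice Yang–Mills in three
dimensions.**  For every 't Hooft coupling `|β| < 1/32` (Assumption 1.1: `K_S = N/2 − 8(d−1)N|β| = 1 − 32|β| > 0`), every infinite-volume
limit point `μ` of the torus `SU(2)` Wilson states at tree coupling `2β`, every finite edge set `Λ` and every smooth cylinder function
`F = f((U_e)_(e∈Λ))`: `μ(F² log F²) − μ(F²) log μ(F²) ≤ (2/K_S) Σ_(e∈Λ) μ(|∇_e F|²)` and `Var_μ(F) ≤ (1/K_S) Σ_(e∈Λ) μ(|∇_e F|²)` — unconditionally,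
from the route's fixed-cut-off Bakry–Émery package (`szzGradientForm_su2_sharp` and `1/K_S ≥ 1/(1 − 24|β|)`).  HONEST FRAMING: strong coupling,
fixed lattice; not a continuum or mass-gap statement. [cite: ShenZhuZhu2022, Theorem 1.4 (1.9)–(1.10) and §4 Corollary 4.5 (4.12)–(4.13)] -/
theorem szzGradientForm_su2_printed {β : ℝ} (hβ : |β| < 1 / 32)
    {μ : Measure (LGConfig 3 (Matrix.specialUnitaryGroup (Fin 2) ℂ))}
    (hμ : μ ∈ infiniteVolumeLimitPoints (d := 3) (fundamentalRep (Fin 2)) (((2 : ℕ) : ℝ) * β))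
    (Λ : Finset (Literature.MathematicalPhysics.QuantumLattice.ZdEdge 3)) (f : (↥Λ → Matrix (Fin 2) (Fin 2) ℂ) → ℝ) (hf : ContDiff ℝ ∞ f) :
    ((∫ U, matrixCylinder Λ f U ^ 2 * Real.log (matrixCylinder Λ f U ^ 2) ∂μ) -
        (∫ U, matrixCylinder Λ f U ^ 2 ∂μ) * Real.log (∫ U, matrixCylinder Λ f U ^ 2 ∂μ) ≤
      2 / szzBakryEmeryConstSU 2 3 β *
        ∑ e : ↥Λ, ∫ U, linkGradSq Λ f e (fun e' : ↥Λ => ((U e'.1 : Matrix.specialUnitaryGroup (Fin 2) ℂ) : Matrix (Fin 2) (Fin 2) ℂ)) ∂μ) ∧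
    (Var[matrixCylinder Λ f; μ] ≤
      1 / szzBakryEmeryConstSU 2 3 β *
        ∑ e : ↥Λ, ∫ U, linkGradSq Λ f e (fun e' : ↥Λ => ((U e'.1 : Matrix.specialUnitaryGroup (Fin 2) ℂ) : Matrix (Fin 2) (Fin 2) ℂ)) ∂μ) := by
  have hKSeq : szzBakryEmeryConstSU 2 3 β = 1 - 32 * |β| := by
    rw [szzBakryEmeryConstSU_eq]; norm_num; ring
  have hKS : 0 < 1 - 32 * |β| := by linarith
  have hβ' : |β| < 1 / 24 := by linarith
  obtain ⟨hE, hV⟩ := szzGradientForm_su2_sharp hβ' hμ Λ f hf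
  have hS : 0 ≤ ∑ e : ↥Λ, ∫ U, linkGradSq Λ f e
      (fun e' : ↥Λ => ((U e'.1 : Matrix.specialUnitaryGroup (Fin 2) ℂ) : Matrix (Fin 2) (Fin 2) ℂ)) ∂μ := by
    refine Finset.sum_nonneg fun e _ => integral_nonneg fun U => ?_
    unfold linkGradSq
    exact Finset.sum_nonneg fun α _ => sq_nonneg _
  have hle : 1 - 32 * |β| ≤ 1 - 24 * |β| := by linarith [abs_nonneg β]
  have h2K : 2 / (1 - 24 * |β|) ≤ 2 / (1 - 32 * |β|) := div_le_div_of_nonneg_left (by norm_num) hKS hle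
  have h1K : 1 / (1 - 24 * |β|) ≤ 1 / (1 - 32 * |β|) := div_le_div_of_nonneg_left (by norm_num) hKS hle
  rw [hKSeq]
  exact ⟨hE.trans (mul_le_mul_of_nonneg_right h2K hS), hV.trans (mul_le_mul_of_nonneg_right h1K hS)⟩

end Summit.QuantumFields.YangMills.Theorems.ColdStartUniversality
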